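import Mathlib.MeasureTheory.Constructions.Polish.Basic
import Literature.Probability.RandomPlanarGeometry.HullRestrictionTests
import Literature.Probability.RandomPlanarGeometry.ConformalMapCaratheodoryProofs
import Literature.Topology.PlaneTopology.JordanCurveProofs

/-!
# Crux `HexConjecture` (stmt-CriticalPhenomena-0808), line `root-locality-replaces-loewner`,
stub `stub_rangeIdentification`: the Lusin–Souslin TRANSFER for laws with equal avoidance codes,
separation of points of `D` from chords, and "a connected subset of a simple arc through its
endpoints is the arc" (part 3a)

Landing target:
`Summits/CriticalPhenomena/SAWScalingLimit/Theorems/SAWDevelopingMapHexConjectureRangeIdentificationTransfer.lean`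
(`--supports stmt-CriticalPhenomena-0808`).

Three deterministic / abstract ingredients of the final identification of the subsequential
limits of the RANGE laws of the critical hexagonal SAW with the law of the range of chordal
SLE(8/3):

* `ext_of_map_code_eq` — on a standard Borel space, two finite measures carried by a Borel set
  `R` on which a measurable code `Ω → (ℕ → Bool)` is injective, and with equal image measures
  under the code, are equal (Lusin–Souslin: `MeasurableSet.image_of_measurable_injOn`); and
  `map_code_eq_of_forall_finset` — image measures under a code agree as soon as the masses of
  the positive cylinders do (π-system of `CurveClass.posCylinder`).  This is the second half of
  `CurveClass.Measure.ext_of_missCode_injOn` (`SimpleCurveLaws`, [LSW] Lemma 3.2 in curve space)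
  made available for laws on the hyperspace `NonemptyCompacts ℂ`;
* `exists_index_separating_of_mem_carrier` — a point of `D` off the trace of a chordal simple
  curve lies in an image test set `imageTest φ n` missing the trace (adapted from
  `exists_index_separating`, whose first curve is replaced by a bare point of `D`);
* `eq_range_of_isPreconnected_subset` — a preconnected subset of the trace of a simple curve
  containing both endpoints is the whole trace (pull back to `[0, 1]`: a preconnected subset of
  `[0, 1]` containing `0` and `1` is everything).

References: A. S. Kechris, *Classical Descriptive Set Theory* (1995), Thm. 15.1 (Lusin–Souslin);
G. F. Lawler, O. Schramm, W. Werner, J. Amer. Math. Soc. **16** (2003), Lemma 3.2.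
-/

noncomputable section

namespace Summit.CriticalPhenomena.SAWScalingLimit.Theorems.HexConjecture.RootLocality.Range

open scoped Topology unitInterval
open Filter Set Metric MeasureTheory
open UpperHalfPlane (upperHalfPlaneSet isOpen_upperHalfPlaneSet)
open Literature.Probability.RandomPlanarGeometry

/-! ### Lusin–Souslin transfer on a standard Borel space -/

section Transfer

variable {Ω : Type*} [MeasurableSpace Ω]

/-- **Image measures under a code agree if the masses of positive cylinders agree**
(`{f | ∀ n ∈ s, f n = true}`, a generating π-system of `ℕ → Bool`; `s = ∅` is the total mass).
[folklore] -/
theorem map_code_eq_of_forall_finset {code : Ω → ℕ → Bool} (hcode : Measurable code)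
    {μ ν : Measure Ω} [IsFiniteMeasure μ] [IsFiniteMeasure ν]
    (h : ∀ s : Finset ℕ, μ (code ⁻¹' CurveClass.posCylinder s) = ν (code ⁻¹' CurveClass.posCylinder s)) :
    μ.map code = ν.map code := by
  have huniv : μ univ = ν univ := by
    have := h ∅
    simpa [CurveClass.posCylinder] using this
  refine ext_of_generate_finite (Set.range CurveClass.posCylinder)
    CurveClass.generateFrom_posCylinder.symm CurveClass.isPiSystem_posCylinder ?_ ?_
  · rintro _ ⟨s, rfl⟩
    rw [Measure.map_apply hcode (CurveClass.measurableSet_posCylinder s),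
      Measure.map_apply hcode (CurveClass.measurableSet_posCylinder s)]
    exact h s
  · rw [Measure.map_apply hcode MeasurableSet.univ, Measure.map_apply hcode MeasurableSet.univ,
      preimage_univ]
    exact huniv

/-- **Lusin–Souslin transfer.** On a standard Borel space, two finite measures carried by a Borel
set `R` on which a measurable code is injective, with equal image measures under the code, are
equal: every Borel `T ⊆ R` is `R ∩ code⁻¹(B)` for the Borel set `B = code(T ∩ R)`.
(Lusin–Souslin, Kechris, *Classical Descriptive Set Theory* (1995), Thm. 15.1; Mathlib's
`MeasurableSet.image_of_measurable_injOn`). [folklore] -/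
theorem ext_of_map_code_eq [StandardBorelSpace Ω] {code : Ω → ℕ → Bool} (hcode : Measurable code)
    {R : Set Ω} (hR : MeasurableSet R) (hinj : InjOn code R) {μ ν : Measure Ω}
    (hμ : ∀ᵐ x ∂μ, x ∈ R) (hν : ∀ᵐ x ∂ν, x ∈ R) (hmap : μ.map code = ν.map code) : μ = ν := by
  have hμR : μ.restrict R = μ := Measure.restrict_eq_self_of_ae_mem hμ
  have hνR : ν.restrict R = ν := Measure.restrict_eq_self_of_ae_mem hν
  ext T hT
  have hB : MeasurableSet (code '' (T ∩ R)) :=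
    (hT.inter hR).image_of_measurable_injOn hcode (hinj.mono inter_subset_right)
  have hpre : code ⁻¹' (code '' (T ∩ R)) ∩ R = T ∩ R :=
    hinj.preimage_image_inter inter_subset_right
  calc μ T = μ (T ∩ R) := by rw [← Measure.restrict_apply hT, hμR]
    _ = μ (code ⁻¹' (code '' (T ∩ R)) ∩ R) := by rw [hpre]
    _ = μ (code ⁻¹' (code '' (T ∩ R))) := by rw [← Measure.restrict_apply (hcode hB), hμR]
    _ = μ.map code (code '' (T ∩ R)) := by rw [Measure.map_apply hcode hB]
    _ = ν.map code (code '' (T ∩ R)) := by rw [hmap]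
    _ = ν (code ⁻¹' (code '' (T ∩ R))) := by rw [Measure.map_apply hcode hB]
    _ = ν (code ⁻¹' (code '' (T ∩ R)) ∩ R) := by rw [← Measure.restrict_apply (hcode hB), hνR]
    _ = ν (T ∩ R) := by rw [hpre]
    _ = ν T := by rw [← Measure.restrict_apply hT, hνR]

/-- **Almost every point has the code of a point of `R`** when the image measures agree and the
other measure is carried by `R` (Lusin–Souslin). [folklore] -/
theorem ae_exists_code_eq [StandardBorelSpace Ω] {code : Ω → ℕ → Bool} (hcode : Measurable code)
    {R : Set Ω} (hR : MeasurableSet R) (hinj : InjOn code R) {μ ν : Measure Ω}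
    [IsProbabilityMeasure μ] [IsProbabilityMeasure ν] (hν : ∀ᵐ x ∂ν, x ∈ R)
    (hmap : μ.map code = ν.map code) : ∀ᵐ x ∂μ, ∃ y ∈ R, code y = code x := by
  have hB : MeasurableSet (code '' R) := hR.image_of_measurable_injOn hcode hinj
  have h1 : ν (code ⁻¹' (code '' R)) = 1 := by
    refine le_antisymm prob_le_one ?_
    have hR1 : ν R = 1 := by
      rw [← prob_compl_eq_zero_iff hR, measure_eq_zero_iff_ae_notMem]
      filter_upwards [hν] with x hx h using h hx
    calc (1 : ENNReal) = ν R := hR1.symm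
      _ ≤ ν (code ⁻¹' (code '' R)) := measure_mono (subset_preimage_image _ _)
  have h2 : μ (code ⁻¹' (code '' R)) = 1 := by
    rw [← Measure.map_apply hcode hB, hmap, Measure.map_apply hcode hB, h1]
  have h3 : ∀ᵐ x ∂μ, x ∈ code ⁻¹' (code '' R) := by
    rw [ae_iff]
    exact (prob_compl_eq_zero_iff (hcode hB)).2 h2
  filter_upwards [h3] with x hx
  obtain ⟨y, hy, hyx⟩ := hx
  exact ⟨y, hy, hyx⟩

end Transfer

/-! ### Separation of a point of `D` from a chord by an image test set -/

section Separation

variable {D : DobrushinDomain} {ψ : ConformalEquiv upperHalfPlaneSet D.carrier}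

-- adapted from `exists_index_separating` (`HullRestrictionTests`): the first curve is replaced
-- by a point `w ∈ D`.
/-- **A point of `D` off a chordal trace is separated from it by an image test set.**
[cite: LawlerSchrammWerner2003Restriction, Lemma 3.2 (p. 10), transposed] -/
theorem exists_index_separating_of_mem_carrier
    (hJarc : Literature.Topology.PlaneTopology.JordanArcSeparation)
    (hC : JordanDomain.exists_continuousOn_extension) (hψ : D.IsChordalUniformizing ψ)
    {c : CurveClass ℂ} (hc : c ∈ chordalCarrier D) {w : ℂ} (hwD : w ∈ D.carrier)
    (hw : w ∉ c.range) : ∃ n, w ∈ imageTest ψ n ∧ Disjoint c.range (imageTest ψ n) := by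
  obtain ⟨⟨⟨⟨γ, hγ, rfl⟩, hs⟩, ht⟩, hr⟩ := hc
  simp only [mem_setOf_eq, CurveClass.source_mk, CurveClass.target_mk, CurveClass.range_mk]
    at hs ht hr hw
  have h0 : γ 0 = D.pt 0 := hs
  have h1 : γ 1 = D.pt 1 := ht
  set z := ψ.symm w with hz
  have hzH : z ∈ upperHalfPlaneSet := ψ.symm_mapsTo hwD
  obtain ⟨K, hKcl, hKc, h0K, hKsub, hKmem, hKrep⟩ := pullback_trace_spec hJarc hC hψ hγ h0 h1 hr
  have hzK : z ∉ K := by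
    intro hzK'
    have hz0 : z ≠ 0 := by
      rintro h; rw [h] at hzH; exact absurd (show (0 : ℝ) < (0 : ℂ).im from hzH) (by simp)
    obtain ⟨t, ht0, ht1, hzt⟩ := hKrep z hzK' hz0
    apply hw
    refine ⟨t, ?_⟩
    have := congrArg ψ hzt
    rw [hz, ψ.apply_symm_apply hwD,
      ψ.apply_symm_apply (apply_mem_carrier_of_chordal hγ h0 h1 hr ht0 ht1)] at this
    exact this.symm
  obtain ⟨l, hl, hzl, hlK⟩ := exists_anchored_testSet hKcl hKc h0K hKsub hzH hzK
  obtain ⟨n, hn⟩ := exists_anchoredSeq_eq hl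
  refine ⟨n, ?_, ?_⟩
  · rw [imageTest, hn]
    refine ⟨z, hzl, ?_⟩
    rw [ψ.boundaryExtension_eq hzH, hz, ψ.apply_symm_apply hwD]
  · rw [imageTest, hn, CurveClass.range_mk]
    refine (MarkedDomain.disjoint_image_boundaryExtension_iff hC hψ (testSet_subset_closure l)
      hl.1 hr).2 ?_
    rintro v ⟨⟨t, rfl⟩, hvD⟩ hvS
    have ht0 : t ≠ 0 := by rintro rfl; exact D.pt_notMem_carrier 0 (h0 ▸ hvD)
    have ht1 : t ≠ 1 := by rintro rfl; exact D.pt_notMem_carrier 1 (h1 ▸ hvD)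
    exact Set.disjoint_left.1 hlK hvS (hKmem t ht0 ht1)

end Separation

/-! ### A connected subset of a simple arc through its endpoints is the arc -/

section Arc

/-- **A preconnected subset of the trace of an injective curve containing both endpoints is the
whole trace**: its parameter set is a preconnected subset of `[0, 1]` (homeomorphism onto the
trace) containing `0` and `1`. [folklore] -/
theorem Curve.eq_range_of_isPreconnected_subset {γ : Curve ℂ} (hγ : γ.IsSimple) {K : Set ℂ}
    (hK : IsPreconnected K) (hKsub : K ⊆ γ.range) (h0 : γ 0 ∈ K) (h1 : γ 1 ∈ K) :
    K = γ.range := by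
  refine hKsub.antisymm ?_
  -- the parameter set of `K` is preconnected (`γ` is an embedding of `[0, 1]`)
  set S : Set I := (⇑γ) ⁻¹' K with hS
  have hemb : Topology.IsClosedEmbedding (⇑γ) := γ.continuous.isClosedEmbedding hγ
  have hSK : (⇑γ) '' S = K := by
    rw [hS, image_preimage_eq_inter_range, inter_eq_left.2 (show K ⊆ Set.range γ from hKsub)]
  have hSc : IsPreconnected S := by
    rw [← hemb.isInducing.isPreconnected_image, hSK]
    exact hK
  -- hence its image in `ℝ` contains `[0, 1]`
  have hSR : IsPreconnected (((↑) : I → ℝ) '' S) := hSc.image _ continuous_subtype_val.continuousOn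
  have h0S : (0 : ℝ) ∈ ((↑) : I → ℝ) '' S := ⟨0, h0, rfl⟩
  have h1S : (1 : ℝ) ∈ ((↑) : I → ℝ) '' S := ⟨1, h1, rfl⟩
  have hIcc : Icc (0 : ℝ) 1 ⊆ ((↑) : I → ℝ) '' S := hSR.Icc_subset h0S h1S
  rintro _ ⟨t, rfl⟩
  obtain ⟨t', ht', htt'⟩ := hIcc t.2
  have : t' = t := Subtype.ext htt'
  rw [← this]
  exact ht'

/-- **A preconnected subset of the trace of a simple curve class containing its two endpoints is
the whole trace.** [folklore] -/
theorem CurveClass.eq_range_of_isPreconnected_subset {c : CurveClass ℂ} (hc : c ∈ CurveClass.simple)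
    {K : Set ℂ} (hK : IsPreconnected K) (hKsub : K ⊆ c.range) (h0 : c.source ∈ K)
    (h1 : c.target ∈ K) : K = c.range := by
  obtain ⟨γ, hγ, rfl⟩ := hc
  exact Curve.eq_range_of_isPreconnected_subset hγ hK hKsub h0 h1

end Arc

/-! ### Registered form (part 3a of `stub_rangeIdentification`) -/

/-- **Registered helper `rangeIdentification_arc`** (crux item stmt-CriticalPhenomena-0808, line
`root-locality-replaces-loewner`, stub `stub_rangeIdentification`, part 3a): a preconnected
subset of the trace of a simple curve class containing both endpoints is the whole trace — the
topological step (iii) "`K = H(K)`" of the range identification. [folklore] -/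
theorem rangeIdentification_arc : ∀ (c : Literature.Probability.RandomPlanarGeometry.CurveClass ℂ) (K : Set ℂ), c ∈ Literature.Probability.RandomPlanarGeometry.CurveClass.simple → IsPreconnected K → K ⊆ c.range → c.source ∈ K → c.target ∈ K → K = c.range :=
  fun _ _ hc hK hKsub h0 h1 => CurveClass.eq_range_of_isPreconnected_subset hc hK hKsub h0 h1

end Summit.CriticalPhenomena.SAWScalingLimit.Theorems.HexConjecture.RootLocality.Range

end
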